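import Summits.CriticalPhenomena.PercolationContinuityZ3.Theorems.Transplant.SkelFrmBFaceHoldsQ3VOf
import Summits.CriticalPhenomena.PercolationContinuityZ3.Theorems.Transplant.SkelFrmBChoiceResidQV
import Summits.CriticalPhenomena.PercolationContinuityZ3.Theorems.Transplant.SkelFrmBChoiceRoomV
import Summits.CriticalPhenomena.PercolationContinuityZ3.Theorems.Transplant.SkelFrmBParamsCorrKGLen
import Summits.CriticalPhenomena.PercolationContinuityZ3.Theorems.Transplant.SkelFrmBParamsFaceBandAR0
import Summits.CriticalPhenomena.PercolationContinuityZ3.Theorems.Transplant.SkelFrmBParamsFaceFloorsX2WA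
import Summits.CriticalPhenomena.PercolationContinuityZ3.Theorems.Transplant.SkelFrmBParamsFaceFloorsY2WA
import Summits.CriticalPhenomena.PercolationContinuityZ3.Theorems.Transplant.SkelFrmBChoiceDefsT
import Summits.CriticalPhenomena.PercolationContinuityZ3.Theorems.Transplant.SkelFrmBChoiceCellsV
import HarnessLib

/-!
# N2 (frames-only node `SamePDropOfSkeletonFrm₁`, OPEN) — (F) column, THE THIN INSTANCE OF RECORD: `NegB.faceHoldsRNQFnLTK_frmChoiceAllQ3V`
# (hp-8 g44; lead g14 RULING J27 2026-08-23T22:22:18Z: PARAMETRIC in the K-floor with the column's own certified floor `480 ≤ Kmin` as the only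
# floor hypothesis; node₂ applies it at `Kmin := 480`; generated by bin/gen_nodev.py)
**`faceHoldsRNQFnLTK_frmChoiceAllQ3V (Kmin) (hKmin : 480 ≤ Kmin) (mk) (gxR fxR exR PxR)`** :
`FaceHoldsRNQFnLTK NegB.LfQ (fun x => x ^ 3) Kmin (frmChoiceAllQ3V (KS.gT mk (gxQ mk gxR fxR)) (KS.fT mk (fxQ mk fxR)) (KS.PR mk (PxQ mk PxR))
(SUS (exQ mk exR) (mxQ (mxF mk))) (cR2W mk) (hFR mk) BSlot.small3)` — the (F) column Prop of the closure of record at THE NODE TUPLE (coherence rule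
2026-08-23T19:48:43Z as amended by J27: `mk := 0`, `Kmin := 480`, the (R) residuals `gxR0/fxR/exR0/PxR` free, `mxR := NegB.mxF mk`), by the tuple-generic
wrapper `faceHoldsRNQFnLTK_frmChoiceAllQ3V_of` with its eight hypotheses DISCHARGED: (1)–(3) the residual dominations `gxFc/fxFc/exF2 ≤ gxQ/fxQ/exQ`
(stmt's `le_gxQ/le_fxQ/exF2_le_exQ`, ResidQV), (4) `m_F ≤ mxQ (mxF mk) = mxF mk` (`mF_le_mxF`, ResidF2 §3), (5) the bridge pair `(MBF, nBF) (cF κ) mk ∈ KS.PR mk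
(PxQ mk PxR)` (`subset_PR_PxQ ….2.1`), (6) `840·Kq + 10 ≤ LfQ K₀ = 3200·Kq` (`LfQ_eq`, `K = 40·Kq`), (7) `600·Kq ≤ cF κ = 1000·Kq + 1` (`cF_eq`), (8) THE FIVE
NODE ROWS from stmt-g22's value kit (2026-08-23T22:11:21Z): the cells' creep and forward room are the truncations `cT`/`hFV` of `cR2vW mk`/`hFRv mk`
(`cOf/hOf` at `cR2W/hFR` by `rfl`; `cT_eq` under `cR2vW_le_r_oth`, `hFV_le`), `hFRv_apply` (`hF₀ = c₀ + 5s₁ + 2`, `hF₁ = c₁ + 54s₀ + 2`), the creep caps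
`cR2vW_caps` (`c₀ ≤ 30s₁ + 1`, `c₁ ≤ 126s₀`), the windows `bwX_eq/bwY_eq` + `small3_eq` (`13s₁`, `69s₀`), the radii `r_i = 40·Kq·s_i` and `6R′0 + 11 ≤ s_i`
(p1's `uA_oth_factsR0` under the box row `4K(R′0+2) ≤ M_L` from `gxFc ≤ gxQ`), the band `E − 1 ≤ 2R′0 − 3` (`R′0 = Rlev0 + 1`, `reach0 < R′0`), and
**`13 ≤ Kq` from the K-floor** (`kq_ge_of_le (m := 12)`; the y-cap row `3c₁ + 78s₀ + 20R′0 + 27 ≤ 40Kq·s₀` is the one that needs `Kq ≥ 12`, J27) — closed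
by the integer arithmetic `faceNodeRows_arith_le` (this file, `omega`; the `≤`-hypothesis form of `faceNodeRows_arith`, SkelFrmBFaceNodeRowsArith).
NON-VACUITY: every hypothesis of the generic wrapper is discharged here from landed value files; the statement has exactly one hypothesis, the K-floor.
builds on p205010 (kernel theorem, internal audit signed; external expert review pending) — nothing here uses p205010; NOTHING is claimed about the open node
`SamePDropOfSkeletonFrm₁` (this is ONE of the three column obligations of its closure of record, not the node).
Lane `prim-bschramm`, seat `prim-hp-8` (gen 44); helper file (`--supports stmt-CriticalPhenomena-4575 --as helper`).
[cite: KozmaNitzan2024, §4 Lemma 11–12 (pp. 21–25), Theorem 6 (pp. 25–31)] [cite: MartineauTassion2017, §4.3]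
-/

noncomputable section

open scoped Classical ENNReal

namespace Summit.CriticalPhenomena.PercolationContinuityZ3.Theorems.Transplant

namespace PlanarSkeletonFrm

namespace NegB

open MeasureTheory Literature.Probability.Percolation Literature.Probability.LatticeModels SimpleGraph KNCells KNLevels GadgetSystem Contour
open Literature.Probability.Percolation.KozmaNitzan
open Literature.Probability.Percolation.KozmaNitzan.Cells (oth sgOf sgOf_sign stepVec_apply_fst)
open Literature.Barriers.CriticalPhenomena (graphBall mem_graphBall_self graphBall_mono)
open BoxProdZ2 (ConcRadiiG Erad Frad nQ nS)
open ChainPlanar ChainPara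
open Skel (winGraph routeW excess WinStepData)
open SkelI (tanOff)
open TwoAxis.Para (modulus detD rep₂)
open SkelConc (Consts)
open Skelφ
open Skelφ.StepI (DataNS OutNS)
open Neg

/-- **The five node rows from `≤`-readings** (pure integer arithmetic; `A∥ := (hF∥ + 1)/2 + (5e + 15)`, `e := E − 1`; the K-floor enters only as
`480·u ≤ r`, `0 ≤ R′`). [folklore] -/
theorem faceNodeRows_arith_le (c₀ c₁ hF₀ hF₁ r₀ r₁ bX bY u₀ u₁ e R' : ℤ)
    (hhF₀ : hF₀ ≤ c₀ + 5 * u₁ + 2) (hhF₁ : hF₁ ≤ c₁ + 54 * u₀ + 2) (hc₀ : c₀ ≤ 30 * u₁ + 1) (hc₁ : c₁ ≤ 126 * u₀)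
    (hbX : 13 * u₁ ≤ bX) (hbY : 69 * u₀ ≤ bY) (hr₀ : 480 * u₀ ≤ r₀) (hr₁ : 480 * u₁ ≤ r₁)
    (hR : 0 ≤ R') (hu₀ : 6 * R' + 11 ≤ u₀) (hu₁ : 6 * R' + 11 ≤ u₁) (he : e + 3 ≤ 2 * R') :
    (2 * ((hF₀ + 1) / 2 + (5 * e + 15)) + 8 * u₁ + 8 + 2 * c₀ ≤ r₁) ∧
      (2 * ((hF₀ + 1) / 2 + (5 * e + 15)) + hF₀ + 6 * u₁ ≤ 2 * c₀ + 2 * bX) ∧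
        (2 * ((hF₁ + 1) / 2 + (5 * e + 15)) + 24 * u₀ + 24 + 2 * c₁ ≤ r₀) ∧
          (2 * ((hF₁ + 1) / 2 + (5 * e + 15)) + hF₁ + 14 * u₀ ≤ 2 * c₁ + 2 * bY) ∧
            (2 * ((hF₁ + 1) / 2 + (5 * e + 15)) + hF₁ + 24 * u₀ + 10 ≤ 2 * c₁ + 2 * bY) := by
  refine ⟨?_, ?_, ?_, ?_, ?_⟩ <;> omega

set_option maxHeartbeats 1600000 in
/-- **THE (F) THIN INSTANCE OF RECORD** (see the module docstring): the face obligation of the choice function of record at the node tuple, under the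
K-floor `480 ≤ Kmin ≤ κ.K₀`. [cite: KozmaNitzan2024, §4 Lemma 12 (pp. 23–25), Theorem 6 (pp. 25–31)] -/
theorem faceHoldsRNQFnLTK_frmChoiceAllQ3V (Kmin : ℕ) (hKmin : 480 ≤ Kmin) (mk : ℕ) (gxR fxR : Neg.FSlot) (exR : GSlot) (PxR : NegB.PSlot) :
    FaceHoldsRNQFnLTK LfQ (fun x => x ^ 3) Kmin
      (frmChoiceAllQ3V (KS.gT mk (gxQ mk gxR fxR)) (KS.fT mk (fxQ mk fxR)) (KS.PR mk (PxQ mk PxR)) (SUS (exQ mk exR) (mxQ (mxF mk)))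
        (cR2W mk) (hFR mk) BSlot.small3) := by
  refine faceHoldsRNQFnLTK_frmChoiceAllQ3V_of mk Kmin cF (gxQ mk gxR fxR) (fxQ mk fxR) (exQ mk exR) (mxQ (mxF mk)) (KS.PR mk (PxQ mk PxR))
    (cR2W mk) (hFR mk) LfQ ?_ ?_ ?_ ?_ ?_ ?_ ?_ ?_
  · intro κ V _ _ G _ Φ t p D _; exact (le_gxQ mk gxR fxR κ Φ t p D).2.1
  · intro κ V _ _ G _ Φ t p D _; exact (le_fxQ mk fxR κ Φ t p D).2.1
  · intro κ V _ _ G _ Φ t p D g f _; exact exF2_le_exQ mk exR κ Φ t p D g f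
  · intro κ V _ _ G _ Φ t p D g f; exact mF_le_mxF κ Φ t p D g f mk
  · intro κ V _ _ G _ Φ t p D _; exact (subset_PR_PxQ mk κ Φ t p D PxR).2.1 (Finset.mem_singleton_self _)
  · intro κ _
    rw [LfQ_eq κ, Neg.K_eq]
    have h1 := Neg.one_le_Kq κ
    omega
  · intro κ _; have := (cF_eq κ).1; omega
  · intro κ V _ _ G _ Φ t p hC O q hK hAt
    -- the tuple's facts at `(O, q)`
    have hAt3 := atQ3_of_atQ3V hAt
    have hAtT := atQ3T_of_atQ3 hAt3
    -- (`gOf/fOf` are unfolded by their equation lemmas — never by unification against the `KS.gT mk (gxQ …)` towers)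
    have hNL := eqNumL_of_atQT hAtT
    have hκ10 := (clauseL_of_atQT hAtT).2
    unfold gOf fOf at hNL hκ10
    have hKq : 13 ≤ Neg.Kq κ := PlanarSkeletonNeg.Neg.kq_ge_of_le κ (m := 12) (by omega)
    have hKq5 : 5 ≤ Neg.Kq κ := by omega
    -- the box row `4·K·(R′0+2) ≤ M_L` and the creep lemmas' floors on `g`
    have hMR0 : 4 * Neg.K κ * (KS0.R'0 κ Φ t p O.merged mk + 2) ≤ ML κ Φ t p O.merged (KS.gT mk (gxQ mk gxR fxR) κ Φ t p O.merged) := by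
      have h := (hR0F_of_ge (fun D => (le_gxQ mk gxR fxR κ Φ t p D).2.1) O.merged).1
      have h4 : 4 * Neg.K κ ≤ 22000 * Neg.Kq κ := by rw [Neg.K_eq]; omega
      exact (Nat.mul_le_mul_right (KS0.R'0 κ Φ t p O.merged mk + 2) h4).trans h
    obtain ⟨hg, hg2⟩ := Hg_Q (κ := κ) (Φ := Φ) (t := t) (p := p) mk gxR fxR O.merged
    -- the stride units vs the radii (`r_J = 40·Kq·u_J`, `6R′0 + 11 ≤ u_J`)
    have hU0 := uA_oth_factsR0 κ Φ t p O.merged (KS.fT mk (fxQ mk fxR) κ Φ t p O.merged) mk (gxQ mk gxR fxR) hNL hκ10 hMR0 1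
    have hU1 := uA_oth_factsR0 κ Φ t p O.merged (KS.fT mk (fxQ mk fxR) κ Φ t p O.merged) mk (gxQ mk gxR fxR) hNL hκ10 hMR0 0
    rw [show oth (1 : Fin 2) = 0 by decide, if_pos rfl] at hU0
    rw [show oth (0 : Fin 2) = 1 by decide, if_neg (by decide)] at hU1
    obtain ⟨hr0, hu0, -⟩ := hU0
    obtain ⟨hr1, hu1, -⟩ := hU1
    have hKq' : (13 : ℤ) ≤ (Neg.Kq κ : ℤ) := by exact_mod_cast hKq
    have hR0 : (0 : ℤ) ≤ (KS0.R'0 κ Φ t p O.merged mk : ℤ) := Nat.cast_nonneg _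
    have hr0' : 480 * (KS.u₀A κ Φ t p O.merged (KS.gT mk (gxQ mk gxR fxR) κ Φ t p O.merged) (KS.fT mk (fxQ mk fxR) κ Φ t p O.merged)) ≤ ((fcellsV κ Φ t p O.merged (KS.gT mk (gxQ mk gxR fxR) κ Φ t p O.merged) (KS.fT mk (fxQ mk fxR) κ Φ t p O.merged) (cOf κ Φ t p O (KS.gT mk (gxQ mk gxR fxR)) (KS.fT mk (fxQ mk fxR)) (cR2W mk)) (hOf κ Φ t p O (KS.gT mk (gxQ mk gxR fxR)) (KS.fT mk (fxQ mk fxR)) (hFR mk))).r 0 : ℤ) := by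
      rw [fcellsV_r, hr0]; nlinarith
    have hr1' : 480 * (KS.u₁A κ Φ t p O.merged (KS.gT mk (gxQ mk gxR fxR) κ Φ t p O.merged) (KS.fT mk (fxQ mk fxR) κ Φ t p O.merged)) ≤ ((fcellsV κ Φ t p O.merged (KS.gT mk (gxQ mk gxR fxR) κ Φ t p O.merged) (KS.fT mk (fxQ mk fxR) κ Φ t p O.merged) (cOf κ Φ t p O (KS.gT mk (gxQ mk gxR fxR)) (KS.fT mk (fxQ mk fxR)) (cR2W mk)) (hOf κ Φ t p O (KS.gT mk (gxQ mk gxR fxR)) (KS.fT mk (fxQ mk fxR)) (hFR mk))).r 1 : ℤ) := by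
      rw [fcellsV_r, hr1]; nlinarith
    -- the creep and the forward room of the cells (truncations are identities / upper bounds)
    have ecv : cOf κ Φ t p O (KS.gT mk (gxQ mk gxR fxR)) (KS.fT mk (fxQ mk fxR)) (cR2W mk) = (cR2vW κ Φ t p O.merged (KS.gT mk (gxQ mk gxR fxR) κ Φ t p O.merged) (KS.fT mk (fxQ mk fxR) κ Φ t p O.merged) mk) := by
      simp only [cOf, gOf, fOf, cR2W]
    have ehv : hOf κ Φ t p O (KS.gT mk (gxQ mk gxR fxR)) (KS.fT mk (fxQ mk fxR)) (hFR mk) = (hFRv κ Φ t p O.merged (KS.gT mk (gxQ mk gxR fxR) κ Φ t p O.merged) (KS.fT mk (fxQ mk fxR) κ Φ t p O.merged) mk) := by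
      simp only [hOf, gOf, fOf, hFR]
    have hcle := cR2vW_le_r_oth κ Φ t p O.merged (KS.gT mk (gxQ mk gxR fxR) κ Φ t p O.merged) (KS.fT mk (fxQ mk fxR) κ Φ t p O.merged) mk hKq5 hNL hg hg2
    have hc0 : ((fcellsV κ Φ t p O.merged (KS.gT mk (gxQ mk gxR fxR) κ Φ t p O.merged) (KS.fT mk (fxQ mk fxR) κ Φ t p O.merged) (cOf κ Φ t p O (KS.gT mk (gxQ mk gxR fxR)) (KS.fT mk (fxQ mk fxR)) (cR2W mk)) (hOf κ Φ t p O (KS.gT mk (gxQ mk gxR fxR)) (KS.fT mk (fxQ mk fxR)) (hFR mk))).c 0 : ℤ) = (((cR2vW κ Φ t p O.merged (KS.gT mk (gxQ mk gxR fxR) κ Φ t p O.merged) (KS.fT mk (fxQ mk fxR) κ Φ t p O.merged) mk) 0 : ℕ) : ℤ) := by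
      rw [fcellsV_c, ecv, cT_eq κ Φ t p O.merged (KS.gT mk (gxQ mk gxR fxR) κ Φ t p O.merged) (KS.fT mk (fxQ mk fxR) κ Φ t p O.merged) _ hcle]
    have hc1 : ((fcellsV κ Φ t p O.merged (KS.gT mk (gxQ mk gxR fxR) κ Φ t p O.merged) (KS.fT mk (fxQ mk fxR) κ Φ t p O.merged) (cOf κ Φ t p O (KS.gT mk (gxQ mk gxR fxR)) (KS.fT mk (fxQ mk fxR)) (cR2W mk)) (hOf κ Φ t p O (KS.gT mk (gxQ mk gxR fxR)) (KS.fT mk (fxQ mk fxR)) (hFR mk))).c 1 : ℤ) = (((cR2vW κ Φ t p O.merged (KS.gT mk (gxQ mk gxR fxR) κ Φ t p O.merged) (KS.fT mk (fxQ mk fxR) κ Φ t p O.merged) mk) 1 : ℕ) : ℤ) := by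
      rw [fcellsV_c, ecv, cT_eq κ Φ t p O.merged (KS.gT mk (gxQ mk gxR fxR) κ Φ t p O.merged) (KS.fT mk (fxQ mk fxR) κ Φ t p O.merged) _ hcle]
    have hF0 : ((fcellsV κ Φ t p O.merged (KS.gT mk (gxQ mk gxR fxR) κ Φ t p O.merged) (KS.fT mk (fxQ mk fxR) κ Φ t p O.merged) (cOf κ Φ t p O (KS.gT mk (gxQ mk gxR fxR)) (KS.fT mk (fxQ mk fxR)) (cR2W mk)) (hOf κ Φ t p O (KS.gT mk (gxQ mk gxR fxR)) (KS.fT mk (fxQ mk fxR)) (hFR mk))).hF 0 : ℤ) ≤ (((hFRv κ Φ t p O.merged (KS.gT mk (gxQ mk gxR fxR) κ Φ t p O.merged) (KS.fT mk (fxQ mk fxR) κ Φ t p O.merged) mk) 0 : ℕ) : ℤ) := by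
      rw [fcellsV_hF, ehv]; exact_mod_cast (hFV_le κ Φ t p O.merged (KS.gT mk (gxQ mk gxR fxR) κ Φ t p O.merged) (KS.fT mk (fxQ mk fxR) κ Φ t p O.merged) _ 0).2
    have hF1 : ((fcellsV κ Φ t p O.merged (KS.gT mk (gxQ mk gxR fxR) κ Φ t p O.merged) (KS.fT mk (fxQ mk fxR) κ Φ t p O.merged) (cOf κ Φ t p O (KS.gT mk (gxQ mk gxR fxR)) (KS.fT mk (fxQ mk fxR)) (cR2W mk)) (hOf κ Φ t p O (KS.gT mk (gxQ mk gxR fxR)) (KS.fT mk (fxQ mk fxR)) (hFR mk))).hF 1 : ℤ) ≤ (((hFRv κ Φ t p O.merged (KS.gT mk (gxQ mk gxR fxR) κ Φ t p O.merged) (KS.fT mk (fxQ mk fxR) κ Φ t p O.merged) mk) 1 : ℕ) : ℤ) := by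
      rw [fcellsV_hF, ehv]; exact_mod_cast (hFV_le κ Φ t p O.merged (KS.gT mk (gxQ mk gxR fxR) κ Φ t p O.merged) (KS.fT mk (fxQ mk fxR) κ Φ t p O.merged) _ 1).2
    obtain ⟨eH0, eH1⟩ := hFRv_apply κ Φ t p O.merged (KS.gT mk (gxQ mk gxR fxR) κ Φ t p O.merged) (KS.fT mk (fxQ mk fxR) κ Φ t p O.merged) mk
    obtain ⟨eC0, eC1⟩ := cR2vW_apply κ Φ t p O.merged (KS.gT mk (gxQ mk gxR fxR) κ Φ t p O.merged) (KS.fT mk (fxQ mk fxR) κ Φ t p O.merged) mk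
    obtain ⟨hcap0, hcap1⟩ := cR2vW_caps κ Φ t p O.merged (KS.gT mk (gxQ mk gxR fxR) κ Φ t p O.merged) (KS.fT mk (fxQ mk fxR) κ Φ t p O.merged) mk hKq5 hNL hg hg2
    have hhF0 : ((fcellsV κ Φ t p O.merged (KS.gT mk (gxQ mk gxR fxR) κ Φ t p O.merged) (KS.fT mk (fxQ mk fxR) κ Φ t p O.merged) (cOf κ Φ t p O (KS.gT mk (gxQ mk gxR fxR)) (KS.fT mk (fxQ mk fxR)) (cR2W mk)) (hOf κ Φ t p O (KS.gT mk (gxQ mk gxR fxR)) (KS.fT mk (fxQ mk fxR)) (hFR mk))).hF 0 : ℤ) ≤ (((cR2vW κ Φ t p O.merged (KS.gT mk (gxQ mk gxR fxR) κ Φ t p O.merged) (KS.fT mk (fxQ mk fxR) κ Φ t p O.merged) mk) 0 : ℕ) : ℤ) + 5 * (KS.u₁A κ Φ t p O.merged (KS.gT mk (gxQ mk gxR fxR) κ Φ t p O.merged) (KS.fT mk (fxQ mk fxR) κ Φ t p O.merged)) + 2 := by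
      rw [eC0]; rw [eH0] at hF0; unfold KS.u₁A; push_cast at hF0 ⊢; linarith
    have hhF1 : ((fcellsV κ Φ t p O.merged (KS.gT mk (gxQ mk gxR fxR) κ Φ t p O.merged) (KS.fT mk (fxQ mk fxR) κ Φ t p O.merged) (cOf κ Φ t p O (KS.gT mk (gxQ mk gxR fxR)) (KS.fT mk (fxQ mk fxR)) (cR2W mk)) (hOf κ Φ t p O (KS.gT mk (gxQ mk gxR fxR)) (KS.fT mk (fxQ mk fxR)) (hFR mk))).hF 1 : ℤ) ≤ (((cR2vW κ Φ t p O.merged (KS.gT mk (gxQ mk gxR fxR) κ Φ t p O.merged) (KS.fT mk (fxQ mk fxR) κ Φ t p O.merged) mk) 1 : ℕ) : ℤ) + 54 * (KS.u₀A κ Φ t p O.merged (KS.gT mk (gxQ mk gxR fxR) κ Φ t p O.merged) (KS.fT mk (fxQ mk fxR) κ Φ t p O.merged)) + 2 := by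
      rw [eC1]; rw [eH1] at hF1; unfold KS.u₀A; push_cast at hF1 ⊢; linarith
    have hcap0' : (((cR2vW κ Φ t p O.merged (KS.gT mk (gxQ mk gxR fxR) κ Φ t p O.merged) (KS.fT mk (fxQ mk fxR) κ Φ t p O.merged) mk) 0 : ℕ) : ℤ) ≤ 30 * (KS.u₁A κ Φ t p O.merged (KS.gT mk (gxQ mk gxR fxR) κ Φ t p O.merged) (KS.fT mk (fxQ mk fxR) κ Φ t p O.merged)) + 1 := by unfold KS.u₁A; exact hcap0
    have hcap1' : (((cR2vW κ Φ t p O.merged (KS.gT mk (gxQ mk gxR fxR) κ Φ t p O.merged) (KS.fT mk (fxQ mk fxR) κ Φ t p O.merged) mk) 1 : ℕ) : ℤ) ≤ 126 * (KS.u₀A κ Φ t p O.merged (KS.gT mk (gxQ mk gxR fxR) κ Φ t p O.merged) (KS.fT mk (fxQ mk fxR) κ Φ t p O.merged)) := by unfold KS.u₀A; exact hcap1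
    -- the windows
    obtain ⟨es0, es1⟩ := small3_eq κ Φ t p O.merged (KS.gT mk (gxQ mk gxR fxR) κ Φ t p O.merged) (KS.fT mk (fxQ mk fxR) κ Φ t p O.merged)
    have hbX : 13 * (KS.u₁A κ Φ t p O.merged (KS.gT mk (gxQ mk gxR fxR) κ Φ t p O.merged) (KS.fT mk (fxQ mk fxR) κ Φ t p O.merged)) ≤ ((KS.bwX κ Φ t p O.merged (KS.gT mk (gxQ mk gxR fxR) κ Φ t p O.merged) (KS.fT mk (fxQ mk fxR) κ Φ t p O.merged)) : ℤ) := by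
      have h := (KS.bwX_eq κ Φ t p O.merged (KS.gT mk (gxQ mk gxR fxR) κ Φ t p O.merged) (KS.fT mk (fxQ mk fxR) κ Φ t p O.merged)).1; rw [es1] at h; unfold KS.u₁A at h ⊢; push_cast at h; linarith
    have hbY : 69 * (KS.u₀A κ Φ t p O.merged (KS.gT mk (gxQ mk gxR fxR) κ Φ t p O.merged) (KS.fT mk (fxQ mk fxR) κ Φ t p O.merged)) ≤ ((KS.bwY κ Φ t p O.merged (KS.gT mk (gxQ mk gxR fxR) κ Φ t p O.merged) (KS.fT mk (fxQ mk fxR) κ Φ t p O.merged)) : ℤ) := by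
      have h := (KS.bwY_eq κ Φ t p O.merged (KS.gT mk (gxQ mk gxR fxR) κ Φ t p O.merged) (KS.fT mk (fxQ mk fxR) κ Φ t p O.merged)).1; rw [es0] at h; unfold KS.u₀A at h ⊢; push_cast at h; linarith
    -- the band `E − 1 ≤ 2R′0 − 3`
    have hE1 : 1 ≤ (KS0.Rlev0 κ Φ t p O.merged mk + KS0.reach0 t O.merged mk) := by unfold KS0.reach0; omega
    have hEc : ((((KS0.Rlev0 κ Φ t p O.merged mk + KS0.reach0 t O.merged mk) - 1 : ℕ)) : ℤ) = ((KS0.Rlev0 κ Φ t p O.merged mk + KS0.reach0 t O.merged mk) : ℤ) - 1 := by omega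
    have hReach : KS0.reach0 t O.merged mk < KS0.R'0 κ Φ t p O.merged mk := (KS0.T0_lt_R'0 κ Φ t p O.merged mk).2.2.1
    have hR' : KS0.R'0 κ Φ t p O.merged mk = KS0.Rlev0 κ Φ t p O.merged mk + 1 := rfl
    have he : ((((KS0.Rlev0 κ Φ t p O.merged mk + KS0.reach0 t O.merged mk) - 1 : ℕ)) : ℤ) + 3 ≤ 2 * (KS0.R'0 κ Φ t p O.merged mk : ℤ) := by
      rw [hEc]; omega
    -- the arithmetic
    have H := faceNodeRows_arith_le ((fcellsV κ Φ t p O.merged (KS.gT mk (gxQ mk gxR fxR) κ Φ t p O.merged) (KS.fT mk (fxQ mk fxR) κ Φ t p O.merged) (cOf κ Φ t p O (KS.gT mk (gxQ mk gxR fxR)) (KS.fT mk (fxQ mk fxR)) (cR2W mk)) (hOf κ Φ t p O (KS.gT mk (gxQ mk gxR fxR)) (KS.fT mk (fxQ mk fxR)) (hFR mk))).c 0) ((fcellsV κ Φ t p O.merged (KS.gT mk (gxQ mk gxR fxR) κ Φ t p O.merged) (KS.fT mk (fxQ mk fxR) κ Φ t p O.merged) (cOf κ Φ t p O (KS.gT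 mk (gxQ mk gxR fxR)) (KS.fT mk (fxQ mk fxR)) (cR2W mk)) (hOf κ Φ t p O (KS.gT mk (gxQ mk gxR fxR)) (KS.fT mk (fxQ mk fxR)) (hFR mk))).c 1) ((fcellsV κ Φ t p O.merged (KS.gT mk (gxQ mk gxR fxR) κ Φ t p O.merged) (KS.fT mk (fxQ mk fxR) κ Φ t p O.merged) (cOf κ Φ t p O (KS.gT mk (gxQ mk gxR fxR)) (KS.fT mk (fxQ mk fxR)) (cR2W mk)) (hOf κ Φ t p O (KS.gT mk (gxQ mk gxR fxR)) (KS.fT mk (fxQ mk fxR)) (hFR mk))).hF 0) ((fcellsV κ Φ t p O.merged (KS.gT mk (gxQ mk gxR fxR) κ Φ t p O.merged) (KS.fT mk (fxQ mk fxR) κ Φ t p O.merged) (cOf κ Φ t p O (KS.gT mk (gxQ mk gxR fxR)) (KS.fT mk (fxQ mk fxR)) (cR2W mk)) (hOf κ Φ t p O (KS.gT mk (gxQ mk gxR fxR)) (KS.fT mk (fxQ mk fxR)) (hFR mk))).hF 1) ((fcellsV κ Φ t p O.merged (KS.gT mk (gxQ mk gxR fxR) κ Φ t p O.merged) (KS.fT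 mk (fxQ mk fxR) κ Φ t p O.merged) (cOf κ Φ t p O (KS.gT mk (gxQ mk gxR fxR)) (KS.fT mk (fxQ mk fxR)) (cR2W mk)) (hOf κ Φ t p O (KS.gT mk (gxQ mk gxR fxR)) (KS.fT mk (fxQ mk fxR)) (hFR mk))).r 0) ((fcellsV κ Φ t p O.merged (KS.gT mk (gxQ mk gxR fxR) κ Φ t p O.merged) (KS.fT mk (fxQ mk fxR) κ Φ t p O.merged) (cOf κ Φ t p O (KS.gT mk (gxQ mk gxR fxR)) (KS.fT mk (fxQ mk fxR)) (cR2W mk)) (hOf κ Φ t p O (KS.gT mk (gxQ mk gxR fxR)) (KS.fT mk (fxQ mk fxR)) (hFR mk))).r 1) ((KS.bwX κ Φ t p O.merged (KS.gT mk (gxQ mk gxR fxR) κ Φ t p O.merged) (KS.fT mk (fxQ mk fxR) κ Φ t p O.merged)) : ℤ) ((KS.bwY κ Φ t p O.merged (KS.gT mk (gxQ mk gxR fxR) κ Φ t p O.merged) (KS.fT mk (fxQ mk fxR) κ Φ t p O.merged)) : ℤ)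
      (KS.u₀A κ Φ t p O.merged (KS.gT mk (gxQ mk gxR fxR) κ Φ t p O.merged) (KS.fT mk (fxQ mk fxR) κ Φ t p O.merged)) (KS.u₁A κ Φ t p O.merged (KS.gT mk (gxQ mk gxR fxR) κ Φ t p O.merged) (KS.fT mk (fxQ mk fxR) κ Φ t p O.merged)) ((((KS0.Rlev0 κ Φ t p O.merged mk + KS0.reach0 t O.merged mk) - 1 : ℕ)) : ℤ) (KS0.R'0 κ Φ t p O.merged mk : ℤ)
      (by rw [hc0]; exact hhF0) (by rw [hc1]; exact hhF1) (by rw [hc0]; exact hcap0') (by rw [hc1]; exact hcap1') hbX hbY hr0' hr1' hR0 hu0 hu1 he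
    exact H

end NegB

end PlanarSkeletonFrm

end Summit.CriticalPhenomena.PercolationContinuityZ3.Theorems.Transplant

end
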